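import Summits.ResolutionOfSingularities.ResolutionOfSingularities.Theorems.EquisingularLiftEquisingularLiftNatTowerConeRoundOldThree
import Summits.ResolutionOfSingularities.ResolutionOfSingularities.Theorems.EquisingularLiftEquisingularLiftNatTowerRoundBDefs
import Summits.ResolutionOfSingularities.ResolutionOfSingularities.Theorems.EquisingularLiftEquisingularLiftNatTowerBTransportFour
import HarnessLib

/-!
# [OURS · L1 W4.5(b) · EL♮(3) · T23-A‴] cone core‴ / K-FIBRE core — THE CONE-WITNESSED ROUND ON `Tower.InvB₄` = `Tower.invB_coneRoundCore'` (p611664,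
# res-L1-w45b-stub-4) with `hfull : TowerFull …` DELETED (every member is MODEL-CARRYING, `Tower.Exc₄`) + the model-less list `Ns`

res-L1-w45b-stub-2 g13 (TAKING 2026-08-28T10:39:53Z; engine word res-L1-w45b-stub-4 v1 DRAFT 3dcf936910c4d869 §3 (U4) «K-fibre core‴ = cone core′ p611664
with `hfull ↦ hZdim`» / (U5); (U1) = `…NatTowerInvBFourDefs` p624526; transport layer = `…NatTowerBTransportFour` p625145; pair / emb twins =
`…NatTowerBPairRoundCoreFour` p625601 / `…NatTowerBEmbRoundCoreFour`). Crux EL♮(3) = stmt-ResolutionOfSingularities-20148 (parent EL♮ stmt-…-20038; node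
stmt-…-15660), route `EquisingularLift`, line `sections`. OURS; NOT a statement of any manuscript; AI-written, weaker than expert review. DEF-FREE; no `sorry`;
standard axioms. `--supports stmt-ResolutionOfSingularities-20148 --as helper`.

WHAT. `Tower.invB₄_coneRoundCore`: the cone-witnessed round hosted by the running surface `E` (centre `Z = E ∩ closure K` via `ConeWitness G E hE K Z hZ`,
upstairs `𝓔 ⊔ 𝒦` from the shadow datum, members by `F = E ∨ Disjoint Z F ∨ X3 F`) with host `hExcH : Tower.Exc₄ …` and candidates at `Exc₄` — NO `TowerFull`
(its only use in p611664 was to exclude a `NoRound` host; `hZdim` never entered the core, so A‴'s K-FIBRE round (branch 5) IS this theorem); members through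
`Tower.exc₄_transport_away` / `Tower.exc₄_transport_transversal'`; model-less `Ns'` = topological transports of closed `F ∈ Ns ∪ (E :: Cs)`
(`Tower.ns_transport_of_closed`); output `Tower.InvB₄ … E' Es' Ns' K'`. Body = p611664 VERBATIM otherwise (adapted copy).
[cite: GortzWedhorn2020, (13.19) and Prop. 13.91] [cite: Liu2002, Thm. 8.1.19] [cite: Matsumura1987, §16] (method; index only).
-/

set_option linter.dupNamespace false -- mandated namespace `Summit.<Summit>.<Problem>` of this single-conjunct summit
noncomputable section
open CategoryTheory CategoryTheory.Limits AlgebraicGeometry TopologicalSpace Topology IsLocalRing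
open Literature.AlgebraicGeometry.Resolution
open AlgebraicGeometry.Scheme.IdealSheafData
open Summit.ResolutionOfSingularities.ResolutionOfSingularities.Theses.EquisingularLift.Split
open Summit.ResolutionOfSingularities.ResolutionOfSingularities.Cruxes.EquisingularLift.StrataSplit
open scoped nonZeroDivisors
namespace Summit.ResolutionOfSingularities.ResolutionOfSingularities.Cruxes.EquisingularLiftNat.Sections

set_option maxHeartbeats 800000 in -- one large assembly over a 20-clause invariant (as in the ₆ files)
/-- **cone core‴ / K-FIBRE core — the cone-witnessed round on `Tower.InvB₄`** (every member model-carrying; NO `TowerFull`; widened transport rule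
`F = E ∨ Disjoint Z F ∨ X3 F`; model-less list `Ns`), at ONE explicit new stage: `Tower.invB_coneRoundCore'` (p611664) minus its `not_towerFull_of_noRound`
line (module docstring). [cite: GortzWedhorn2020, (13.19) and Prop. 13.91] [cite: Liu2002, Thm. 8.1.19] [OURS · L1 W4.5b · T23-A‴ engine] clause (round,
branches 2 / 5) of the B‴-driver; NOT a statement of the manuscript. -/
theorem Tower.invB₄_coneRoundCore (O : Type) [CommRing O] [IsDomain O] [IsDiscreteValuationRing O] (k : Type) [Field k]
    (θ : O →+* k) (hθ : Function.Surjective θ)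
    (P : Scheme.{0}) (q : P ⟶ Spec (.of O)) [IsProper q] (Y : Set P) (hYirr : IsIrreducible Y) (hYcl : IsClosed Y)
    (hPnoeth : IsLocallyNoetherian P) (hPreg : Scheme.IsRegular P)
    (Ch : ∀ X' : Scheme.{0}, (X' ⟶ P) → Set X' → Prop)
    (hChain : ∀ (X' : Scheme.{0}) (σ : X' ⟶ P) (S : Set X'), Ch X' σ S → Chain P Y X' σ S)
    (hStep : ∀ (X' X'' : Scheme.{0}) (σ' : X' ⟶ P) (S' : Set X') (C : X'.IdealSheafData) (τ : X'' ⟶ X'),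
      Ch X' σ' S' → IsBlowup τ C → Scheme.IsRegular C.subscheme → Flat (C.subschemeι ≫ σ' ≫ q) →
      σ' '' (C.support : Set X') ⊆ {x : P | ¬ IsGenericPoint x Y} →
      (C.support : Set X') ∩ (σ' ≫ q) ⁻¹' {IsLocalRing.closedPoint O} ⊆ S' →
      Ch X'' (τ ≫ σ') (closure (τ ⁻¹' (S' \ (C.support : Set X')))))
    (Ruled : Tower.RuledDatum P)
    {F₉ : Scheme.{0}} (Z₉ : Set F₉) (hZ₉ : IsClosed Z₉) {F₁₀ : Scheme.{0}} (υ' : F₁₀ ⟶ F₉)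
    (hRuledIso : ∀ (G₀ G₀' : Scheme.{0}) (γ₀ : G₀ ⟶ F₁₀) (γ₀' : G₀' ⟶ F₁₀) (E₀ : Set G₀) (E₀' : Set G₀') (X₀ X₀'' : Scheme.{0})
        (σ₀ : X₀ ⟶ P) (j₀ : G₀ ⟶ X₀) (j₀' : G₀' ⟶ X₀'') (𝓔₀ : X₀.IdealSheafData) (𝓔₀' : X₀''.IdealSheafData) (τ₀ : X₀'' ⟶ X₀),
      (∃ e : 𝓔₀'.subscheme ≅ 𝓔₀.subscheme, e.hom ≫ 𝓔₀.subschemeι = 𝓔₀'.subschemeι ≫ τ₀) →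
      Ruled F₉ Z₉ hZ₉ F₁₀ υ' G₀ γ₀ E₀ X₀ σ₀ j₀ 𝓔₀ → Ruled F₉ Z₉ hZ₉ F₁₀ υ' G₀' γ₀' E₀' X₀'' (τ₀ ≫ σ₀) j₀' 𝓔₀')
    -- T23-A′: the ruled datum follows STRICT TRANSFORMS under blow-ups (at the engine's `FE` = stub-2's `flat_strictTransform_subschemeι_comp`)
    (hRuledSt : ∀ (G₀ G₀' : Scheme.{0}) (γ₀ : G₀ ⟶ F₁₀) (γ₀' : G₀' ⟶ F₁₀) (E₀ : Set G₀) (E₀' : Set G₀') (X₀ X₀'' : Scheme.{0})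
        (σ₀ : X₀ ⟶ P) (j₀ : G₀ ⟶ X₀) (j₀' : G₀' ⟶ X₀'') (𝓔₀ C₀ : X₀.IdealSheafData) (τ₀ : X₀'' ⟶ X₀),
      IsBlowup τ₀ C₀ → IsLocallyNoetherian X₀ → IsLocallyNoetherian X₀'' →
      Ruled F₉ Z₉ hZ₉ F₁₀ υ' G₀ γ₀ E₀ X₀ σ₀ j₀ 𝓔₀ →
      Ruled F₉ Z₉ hZ₉ F₁₀ υ' G₀' γ₀' E₀' X₀'' (τ₀ ≫ σ₀) j₀' (strictTransformIdeal τ₀ C₀ 𝓔₀))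
    (G G' : Scheme.{0}) (γ : G ⟶ F₁₀) (T E K : Set G) (Cs : List (Set G)) (hE : IsClosed E) (Z : Set G) (hZ : IsClosed Z)
    (υ₂ : G' ⟶ G)
    -- the old invariant, UNPACKED at its stage, with the running surface's datum and the shadow-forgotten candidates
    (hυ' : IsBlowup υ' (vanishingIdeal (⟨Z₉, hZ₉⟩ : Closeds F₉))) (hZinf : Z₉.Infinite) [IsIntegral G]
    (hTirr : IsIrreducible T) (hTE₀ : ¬ T ⊆ E)
    (X : Scheme.{0}) (σ : X ⟶ P) (S : Set X) (jG : G ⟶ X) (tG : G ⟶ Spec (.of k))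
    (hCh : Ch X σ S) [IsIntegral X] [IsLocallyNoetherian X] (hXreg : Scheme.IsRegular X) (hdom : IsDominant (σ ≫ q))
    (hsq : IsPullback jG tG (σ ≫ q) (Spec.map (CommRingCat.ofHom θ))) (hTS : jG '' T = S)
    (hExcE : Tower.Exc₄ O P q Y Ruled Z₉ hZ₉ υ' G γ E hE K X σ jG)
    (hCand : ∀ F ∈ Cs, ∃ hF : IsClosed F, ¬ T ⊆ F ∧ Tower.Exc₄ O P q Y Ruled Z₉ hZ₉ υ' G γ F hF ∅ X σ jG)
    -- the model-less retained list (topology only)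
    (Ns : List (Set G)) (hNs : ∀ F ∈ Ns, IsClosed F ∧ ¬ T ⊆ F)
    -- the round
    (hZET : Z ⊆ E ∩ T) (hZne : Z.Nonempty) (hcone : ConeWitness G E hE K Z hZ)
    (hυ₂ : IsBlowup υ₂ (vanishingIdeal ⟨Z, hZ⟩))
    (hKcl : IsClosed K) (hKE : K ⊆ closure (K \ E)) (hKne : K ≠ Set.univ) (hEZ : E ⊆ closure (E \ Z))
    -- BIRTH of the datum for the NEW surface (029's `hRuled` of `_new` verbatim)
    (hRuledBorn : ∀ (X : Scheme.{0}) (σ : X ⟶ P) (S : Set X) (jG : G ⟶ X) (tG : G ⟶ Spec (.of k)) (𝓔 𝒦 : X.IdealSheafData)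
        (X'' : Scheme.{0}) (τ : X'' ⟶ X) (j₂ : G' ⟶ X'') (t₂ : G' ⟶ Spec (.of k)),
        Ch X σ S → IsIntegral X → IsLocallyNoetherian X → Scheme.IsRegular X → IsDominant (σ ≫ q) →
        IsPullback jG tG (σ ≫ q) (Spec.map (CommRingCat.ofHom θ)) → jG '' T = S →
        (𝓔 ⊔ 𝒦).comap jG = vanishingIdeal ⟨Z, hZ⟩ → Flat ((𝓔 ⊔ 𝒦).subschemeι ≫ σ ≫ q) → Scheme.IsRegular (𝓔 ⊔ 𝒦).subscheme →
        Scheme.IsRegular 𝓔.subscheme → IsBlowup τ (𝓔 ⊔ 𝒦) → IsPullback j₂ t₂ ((τ ≫ σ) ≫ q) (Spec.map (CommRingCat.ofHom θ)) →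
        j₂ ≫ τ = υ₂ ≫ jG →
        Ruled F₉ Z₉ hZ₉ F₁₀ υ' G' (υ₂ ≫ γ) (υ₂ ⁻¹' Z) X'' (τ ≫ σ) j₂ ((𝓔 ⊔ 𝒦).comap τ))
    -- the producer's menus
    (K' E' : Set G') (Es' Ns' : List (Set G'))
    (hK' : K' = ∅ ∨ K' = closure (υ₂ ⁻¹' (K \ Z)))
    (hE' : E' = υ₂ ⁻¹' Z ∨ E' = closure (υ₂ ⁻¹' (E \ Z)))
    -- T23-A′: the downstairs THIRD transport alternative `X3 F` (text owner's choice) and its two upstairs dischargers at THIS stage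
    (X3 : Set G → Prop)
    (hSNC : ∀ (C 𝓕 : X.IdealSheafData) (F : Set G) (hF : IsClosed F), X3 F → IsProper (σ ≫ q) →
      C.comap jG = vanishingIdeal ⟨Z, hZ⟩ → Flat (C.subschemeι ≫ σ ≫ q) → Scheme.IsRegular C.subscheme →
      𝓕.comap jG = vanishingIdeal ⟨F, hF⟩ → (∀ z : X, (stalkIdeal 𝓕 z).IsPrincipal) → Scheme.IsRegular 𝓕.subscheme →
      σ '' (𝓕.support : Set X) ⊆ {p : P | ¬ IsGenericPoint p Y} → Ruled F₉ Z₉ hZ₉ F₁₀ υ' G γ F X σ jG 𝓕 → ¬ T ⊆ F →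
      HasSNCWith [𝓕] C)
    (hTrace : ∀ (C 𝓕 : X.IdealSheafData) (F : Set G) (hF : IsClosed F) (X₂ : Scheme.{0}) (τ : X₂ ⟶ X) (j₂ : G' ⟶ X₂)
        (t₂ : G' ⟶ Spec (.of k)), X3 F → IsProper (σ ≫ q) →
      C.comap jG = vanishingIdeal ⟨Z, hZ⟩ → Flat (C.subschemeι ≫ σ ≫ q) → Scheme.IsRegular C.subscheme →
      IsBlowup τ C → IsLocallyNoetherian X₂ → IsPullback j₂ t₂ ((τ ≫ σ) ≫ q) (Spec.map (CommRingCat.ofHom θ)) → j₂ ≫ τ = υ₂ ≫ jG →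
      𝓕.comap jG = vanishingIdeal ⟨F, hF⟩ → (∀ z : X, (stalkIdeal 𝓕 z).IsPrincipal) → Scheme.IsRegular 𝓕.subscheme →
      σ '' (𝓕.support : Set X) ⊆ {p : P | ¬ IsGenericPoint p Y} → Ruled F₉ Z₉ hZ₉ F₁₀ υ' G γ F X σ jG 𝓕 → ¬ T ⊆ F →
      HasSNCWith [𝓕] C →
      (strictTransformIdeal τ C 𝓕).comap j₂ = vanishingIdeal (⟨closure (υ₂ ⁻¹' (F \ Z)), isClosed_closure⟩ : Closeds G'))
    (hEs' : ∀ F' ∈ Es', ∃ F ∈ Cs, (F = E ∨ Disjoint Z F ∨ X3 F) ∧ F' = closure (υ₂ ⁻¹' (F \ Z)))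
    (hNs' : ∀ F' ∈ Ns', ∃ F : Set G, (F ∈ Ns ∨ F ∈ E :: Cs) ∧ F' = closure (υ₂ ⁻¹' (F \ Z))) :
    Tower.InvB₄ O k θ P q Y Ch Ruled F₉ Z₉ hZ₉ F₁₀ υ' G' (υ₂ ≫ γ) (closure (υ₂ ⁻¹' (T \ Z))) E' Es' Ns' K' := by
  classical
  have hZE : Z ⊆ E := fun z hz => (hZET hz).1
  have hZT : Z ⊆ T := fun z hz => (hZET hz).2
  obtain ⟨𝓔, he_i, he_ii, he_iii, he_iv, he_v, hshadow⟩ := hExcE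
  obtain ⟨hZeq, hwit⟩ := hcone
  rcases hshadow with hK0 | ⟨𝒦, hk_i, ⟨V, hEV, hk_ii⟩, hk_iii, hk_iv, hk_v, hk_vi⟩
  · exfalso
    rw [hK0, closure_empty, Set.inter_empty] at hZeq
    exact hZne.ne_empty hZeq
  -- properness of the stage; the model square
  obtain ⟨-, -, hσ⟩ := chain_isRegular P Y X σ S (hChain _ _ _ hCh) hPnoeth hPreg
  haveI := hσ
  haveI : IsProper (σ ≫ q) := inferInstance
  haveI : IsClosedImmersion (Spec.map (CommRingCat.ofHom θ)) := IsClosedImmersion.spec_of_surjective _ hθ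
  haveI hjci : IsClosedImmersion jG := MorphismProperty.IsStableUnderBaseChange.of_isPullback hsq.flip inferInstance
  haveI : IsLocallyNoetherian G := LocallyOfFiniteType.isLocallyNoetherian jG
  have hjsp : ∀ z : G, (σ ≫ q) (jG z) = closedPoint O := fun z => by
    have h1 : jG z ∈ Set.range jG := ⟨z, rfl⟩
    rw [range_eq_preimage_of_isPullback hsq, range_specMap_of_surjective_of_field θ hθ] at h1
    exact h1
  have hrangej : Set.range jG = (σ ≫ q) ⁻¹' {closedPoint O} := by
    rw [range_eq_preimage_of_isPullback hsq, range_specMap_of_surjective_of_field θ hθ]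
  -- the centre `𝒞 := 𝓔 ⊔ 𝒦`: exact trace `𝓘⟨Z⟩` (the cone witness), flat (k-iii), regular, off the generic point
  have hCD : (𝓔 ⊔ 𝒦).comap jG = vanishingIdeal ⟨Z, hZ⟩ := by
    rw [comap_sup_eq_vanishingIdeal_sup_of_loc jG 𝓔 𝒦 hE he_i V hEV hk_ii, hwit]
  have hZEK : (⟨E ∩ closure K, hE.inter isClosed_closure⟩ : Closeds G) = ⟨Z, hZ⟩ := Closeds.ext hZeq.symm
  have hCreg_pt : ∀ x ∈ ((𝓔 ⊔ 𝒦).support : Set X), (σ ≫ q) x = closedPoint O →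
      IsRegularLocalRing (X.presheaf.stalk x ⧸ stalkIdeal (𝓔 ⊔ 𝒦) x) := by
    intro x hx hqx
    obtain ⟨y, rfl⟩ : x ∈ Set.range jG := by rw [hrangej]; exact hqx
    refine hk_iv y hx ?_
    rw [hZEK, hwit]
  haveI : IsProper ((𝓔 ⊔ 𝒦).subschemeι ≫ σ ≫ q) := inferInstance
  have hCreg : Scheme.IsRegular (𝓔 ⊔ 𝒦).subscheme :=
    Scheme.isRegular_subscheme_of_forall_over_closedPoint (σ ≫ q) (𝓔 ⊔ 𝒦) fun x hx hqx => hCreg_pt x hx hqx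
  have hiv : σ '' ((𝓔 ⊔ 𝒦).support : Set X) ⊆ {p : P | ¬ IsGenericPoint p Y} := by
    rintro _ ⟨x, hx, rfl⟩
    exact he_iv ⟨x, Scheme.IdealSheafData.support_antitone le_sup_left hx, rfl⟩
  -- support bookkeeping downstairs
  have hsuppZ : ((vanishingIdeal ⟨Z, hZ⟩ : G.IdealSheafData).support : Set G) = Z := Scheme.IdealSheafData.coe_support_vanishingIdeal _
  have hDT : ((vanishingIdeal ⟨Z, hZ⟩ : G.IdealSheafData).support : Set G) ⊆ T := by rw [hsuppZ]; exact hZT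
  have hTZ : ¬ T ⊆ Z := fun h => hTE₀ (h.trans hZE)
  have hTD : ¬ T ⊆ ((vanishingIdeal ⟨Z, hZ⟩ : G.IdealSheafData).support : Set G) := by rw [hsuppZ]; exact hTZ
  -- blow up the centre ONCE and run the model step
  obtain ⟨X₂, τ, hτ⟩ := exists_isBlowup X (𝓔 ⊔ 𝒦)
  obtain ⟨hint₂, hnoeth₂, hreg₂, hdom₂, hF₂, hirr, j₂, t₂, hsq₂, hcomm, hCh₂⟩ :=
    modelStep_chain O k θ hθ P q Y hYirr hYcl Ch hChain hStep X σ S hCh hXreg hdom G jG tG hsq T hTS (𝓔 ⊔ 𝒦)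
      (vanishingIdeal ⟨Z, hZ⟩) hCD hCreg hk_iii hiv hDT hTD X₂ τ hτ G' υ₂ hυ₂
  rw [hsuppZ] at hirr hCh₂
  haveI := hint₂
  haveI := hnoeth₂
  haveI := hF₂
  haveI : IsProper τ := hτ.isProper
  have hcart : IsPullback j₂ υ₂ τ jG := isPullback_of_model_squares θ hθ (σ ≫ q) τ jG tG hsq j₂ t₂
    (by simpa only [Category.assoc] using hsq₂) υ₂ hcomm
  -- a point of `G'` off the exceptional surface, `T' ⊄ E'`, `T' ⊄ E''`, the centre is non-zero
  obtain ⟨t, htT, htE⟩ := Set.not_subset.mp hTE₀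
  have htZ : t ∉ Z := fun h => htE (hZE h)
  obtain ⟨t', ht'⟩ := hυ₂.exists_preimage_of_not_mem_support (z := t) (by rw [hsuppZ]; exact htZ)
  have hTEnew : ¬ closure (υ₂ ⁻¹' (T \ Z)) ⊆ υ₂ ⁻¹' Z := by
    intro h
    have h1 : t' ∈ closure (υ₂ ⁻¹' (T \ Z)) := subset_closure (show υ₂ t' ∈ T \ Z by rw [ht']; exact ⟨htT, htZ⟩)
    have h2 : υ₂ t' ∈ Z := h h1
    rw [ht'] at h2
    exact htZ h2
  have hTEold : ¬ closure (υ₂ ⁻¹' (T \ Z)) ⊆ closure (υ₂ ⁻¹' (E \ Z)) := by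
    intro h
    have h1 : t' ∈ closure (υ₂ ⁻¹' (T \ Z)) := subset_closure (show υ₂ t' ∈ T \ Z by rw [ht']; exact ⟨htT, htZ⟩)
    have h2 : t' ∈ υ₂ ⁻¹' E :=
      (closure_minimal (Set.preimage_mono fun x hx => hx.1) (hE.preimage υ₂.continuous)) (h h1)
    rw [Set.mem_preimage, ht'] at h2
    exact htE h2
  have hCne : 𝓔 ⊔ 𝒦 ≠ ⊥ := by
    rintro hbot
    obtain ⟨u, hu, hKu⟩ := hτ.isEffectiveCartier.exists_stalkIdeal_eq_span (j₂ t')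
    rw [hbot, Scheme.IdealSheafData.comap_bot, stalkIdeal_bot, eq_comm, Ideal.span_singleton_eq_bot] at hKu
    rw [hKu] at hu
    exact zero_notMem_nonZeroDivisors hu
  -- the centre's special points lie in `jG '' Z`
  have hCDpts : ((𝓔 ⊔ 𝒦).support : Set X) ∩ (σ ≫ q) ⁻¹' {closedPoint O} ⊆ jG '' Z := by
    rintro c ⟨hcC, hcsp⟩
    have hc : c ∈ Set.range jG := by rw [hrangej]; exact hcsp
    obtain ⟨g, rfl⟩ := hc
    refine ⟨g, ?_, rfl⟩
    have h1 : g ∈ (((𝓔 ⊔ 𝒦).comap jG).support : Set G) := by rw [support_comap]; exact hcC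
    rw [hCD, hsuppZ] at h1
    exact h1
  have hqr : ∀ z ∈ ((⟨Z, hZ⟩ : Closeds G) : Set G), ∃ (n : ℕ) (c : Fin n → X.presheaf.stalk (jG z)),
      Ideal.span (Set.range c) = stalkIdeal (𝓔 ⊔ 𝒦) (jG z) ∧ IsQuasiRegular c := by
    intro z hz
    have hzC : jG z ∈ ((𝓔 ⊔ 𝒦).support : Set X) := by
      have h1 : z ∈ (((𝓔 ⊔ 𝒦).comap jG).support : Set G) := by rw [hCD, hsuppZ]; exact hz
      rw [Scheme.IdealSheafData.support_comap] at h1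
      exact h1
    haveI : IsRegularLocalRing (X.presheaf.stalk (jG z)) := hXreg (jG z)
    haveI : IsRegularLocalRing (X.presheaf.stalk (jG z) ⧸ stalkIdeal (𝓔 ⊔ 𝒦) (jG z)) := hCreg_pt _ hzC (hjsp z)
    obtain ⟨n, c, -, hc, hq, -⟩ := exists_isQuasiRegular_span_eq_of_isRegularLocalRing_quotient
      (J := stalkIdeal (𝓔 ⊔ 𝒦) (jG z)) ((mem_support_iff_stalkIdeal_le _ _).mp hzC) (stalkIdeal (𝓔 ⊔ 𝒦) (jG z) : Set _)
      (Ideal.span_eq _)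
    exact ⟨n, c, hc, hq⟩
  have he1 : ((𝓔 ⊔ 𝒦).comap τ).comap j₂ = vanishingIdeal ⟨υ₂ ⁻¹' Z, hZ.preimage υ₂.continuous⟩ :=
    comap_comap_eq_vanishingIdeal_preimage_of_model O k θ hθ (σ ≫ q) jG tG hsq (𝓔 ⊔ 𝒦) τ hτ j₂ t₂
      (by simpa only [Category.assoc] using hsq₂) υ₂ hcomm ⟨Z, hZ⟩ hCD hqr
  have he2 : ∀ z : X₂, (stalkIdeal ((𝓔 ⊔ 𝒦).comap τ) z).IsPrincipal := fun z => by
    obtain ⟨u, -, hu⟩ := hτ.isEffectiveCartier.exists_stalkIdeal_eq_span z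
    exact ⟨⟨u, by rw [hu, Ideal.submodule_span_eq]⟩⟩
  have he3 : Scheme.IsRegular ((𝓔 ⊔ 𝒦).comap τ).subscheme := hτ.isRegular_subscheme_comap hXreg hCreg
  have he4 : (τ ≫ σ) '' (((𝓔 ⊔ 𝒦).comap τ).support : Set X₂) ⊆ {p : P | ¬ IsGenericPoint p Y} := by
    rintro _ ⟨z, hz, rfl⟩
    rw [Scheme.IdealSheafData.support_comap] at hz
    exact hiv ⟨τ z, hz, rfl⟩
  have he5 : Ruled F₉ Z₉ hZ₉ F₁₀ υ' G' (υ₂ ≫ γ) (υ₂ ⁻¹' Z) X₂ (τ ≫ σ) j₂ ((𝓔 ⊔ 𝒦).comap τ) :=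
    hRuledBorn X σ S jG tG 𝓔 𝒦 X₂ τ j₂ t₂ hCh inferInstance inferInstance hXreg hdom hsq hTS hCD hk_iii hCreg he_iii hτ hsq₂ hcomm
  have hk1 : ∀ z : X₂, (stalkIdeal (strictTransformIdeal τ (𝓔 ⊔ 𝒦) 𝒦) z).IsPrincipal := fun z =>
    isPrincipal_stalkIdeal_strictTransformIdeal hXreg hCreg hτ hCne 𝒦 hk_i z
  have hKc : K = closure K := hKcl.closure_eq.symm
  have hk2 : ((strictTransformIdeal τ (𝓔 ⊔ 𝒦) 𝒦).comap j₂).comap (υ₂ ⁻¹ᵁ V).ι =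
      (vanishingIdeal (⟨closure (closure (υ₂ ⁻¹' (K \ Z))), isClosed_closure⟩ : Closeds G')).comap (υ₂ ⁻¹ᵁ V).ι := by
    have hdense : ((⟨closure K, isClosed_closure⟩ : Closeds G) : Set G) ∩ (V : Set G) ⊆
        closure (((⟨closure K, isClosed_closure⟩ : Closeds G) : Set G) \ (⟨Z, hZ⟩ : Closeds G)) := by
      intro x hx
      have hx1 : x ∈ K := by rw [hKc]; exact hx.1
      have hsub : K ⊆ closure (K \ Z) := hKE.trans (closure_mono fun x hx => ⟨hx.1, fun hxZ => hx.2 (hZE hxZ)⟩)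
      change x ∈ closure (closure K \ Z)
      rw [← hKc]
      exact hsub hx1
    have h := coneRound_shadow_comap_loc 𝓔 𝒦 hk_v hτ hcart ⟨closure K, isClosed_closure⟩ ⟨Z, hZ⟩ V hk_ii hυ₂ hdense
    rw [h]
    congr 2
    refine Closeds.ext ?_
    change closure (υ₂ ⁻¹' (closure K \ Z)) = closure (closure (υ₂ ⁻¹' (K \ Z)))
    rw [closure_closure, ← hKc]
  have hk3 : Flat ((((𝓔 ⊔ 𝒦).comap τ) ⊔ strictTransformIdeal τ (𝓔 ⊔ 𝒦) 𝒦).subschemeι ≫ (τ ≫ σ) ≫ q) := by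
    have h := coneRound_flat 𝓔 𝒦 hk_v hτ (σ ≫ q) hk_iii
    simpa only [Category.assoc] using h
  have hk4reg : Scheme.IsRegular (((𝓔 ⊔ 𝒦).comap τ) ⊔ strictTransformIdeal τ (𝓔 ⊔ 𝒦) 𝒦).subscheme :=
    coneRound_isRegular 𝓔 𝒦 hk_v hτ hCreg
  have hk4 : ∀ (E'' : Set G') (hE'' : IsClosed E'') (K'' : Set G') (y : G'),
      j₂ y ∈ ((((𝓔 ⊔ 𝒦).comap τ) ⊔ strictTransformIdeal τ (𝓔 ⊔ 𝒦) 𝒦).support : Set X₂) →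
      stalkIdeal (vanishingIdeal (⟨E'', hE''⟩ : Closeds G') ⊔
        vanishingIdeal (⟨closure K'', isClosed_closure⟩ : Closeds G')) y =
      stalkIdeal (vanishingIdeal (⟨E'' ∩ closure K'', hE''.inter isClosed_closure⟩ : Closeds G')) y →
      IsRegularLocalRing (X₂.presheaf.stalk (j₂ y) ⧸
        stalkIdeal (((𝓔 ⊔ 𝒦).comap τ) ⊔ strictTransformIdeal τ (𝓔 ⊔ 𝒦) 𝒦) (j₂ y)) := by
    intro E'' hE'' K'' y hy _
    obtain ⟨s, hs⟩ : j₂ y ∈ Set.range (((𝓔 ⊔ 𝒦).comap τ) ⊔ strictTransformIdeal τ (𝓔 ⊔ 𝒦) 𝒦).subschemeι := by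
      rw [Scheme.IdealSheafData.range_subschemeι]; exact hy
    have h := (isRegularLocalRing_stalk_subscheme_iff _ s).mp (hk4reg s)
    rw [show (((𝓔 ⊔ 𝒦).comap τ) ⊔ strictTransformIdeal τ (𝓔 ⊔ 𝒦) 𝒦).subschemeι.base s = j₂ y from hs] at h
    exact h
  have hk5 : IsEffectiveCartier (((𝓔 ⊔ 𝒦).comap τ).comap (strictTransformIdeal τ (𝓔 ⊔ 𝒦) 𝒦).subschemeι) :=
    isEffectiveCartier_cone_next 𝓔 𝒦 hτ
  have hKne' : 𝒦 ≠ ⊥ := by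
    intro hK0
    have hVK : (V : Set G) ⊆ closure K := fun x hx =>
      (mem_support_iff_mem_closure_of_comap_ι_eq jG 𝒦 K V hk_ii hx).mp (by rw [hK0, Scheme.IdealSheafData.support_bot]; trivial)
    obtain ⟨z, hz⟩ := hZne
    have hVne : (V : Set G).Nonempty := ⟨z, hEV (hZE hz)⟩
    have hdenseV : Dense (V : Set G) := V.2.dense hVne
    apply hKne
    rw [hKc]
    exact Set.eq_univ_of_univ_subset ((hdenseV.closure_eq ▸ closure_minimal hVK isClosed_closure :
      (Set.univ : Set G) ⊆ closure K))
  have hStne : strictTransformIdeal τ (𝓔 ⊔ 𝒦) 𝒦 ≠ ⊥ := by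
    intro h0
    have hle : 𝒦.comap τ ≤ strictTransformIdeal τ (𝓔 ⊔ 𝒦) 𝒦 := comap_le_strictTransformIdeal τ (𝓔 ⊔ 𝒦) 𝒦
    rw [h0, le_bot_iff] at hle
    apply stalkIdeal_ne_bot_of_ne_bot hKne' (τ (j₂ t'))
    have h3 : stalkIdeal (𝒦.comap τ) (j₂ t') = ⊥ := by rw [hle, stalkIdeal_bot]
    rw [stalkIdeal_comap_eq_map_stalkMap] at h3
    exact (Ideal.map_eq_bot_iff_of_injective (hτ.stalkMap_injective (j₂ t'))).mp h3
  have hk6 : IsEffectiveCartier ((strictTransformIdeal τ (𝓔 ⊔ 𝒦) 𝒦).comap ((𝓔 ⊔ 𝒦).comap τ).subschemeι) :=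
    isEffectiveCartier_comap_subschemeι_swap ((𝓔 ⊔ 𝒦).comap τ) (strictTransformIdeal τ (𝓔 ⊔ 𝒦) 𝒦) he2 hk1 he3 hStne hk5
  have hExcNew : ∀ hE' : IsClosed (υ₂ ⁻¹' Z),
      Tower.Exc₄ O P q Y Ruled Z₉ hZ₉ υ' G' (υ₂ ≫ γ) (υ₂ ⁻¹' Z) hE' K' X₂ (τ ≫ σ) j₂ := by
    intro hE'
    refine ⟨(𝓔 ⊔ 𝒦).comap τ, he1, he2, he3, he4, he5, ?_⟩
    rcases hK' with hK0 | hKst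
    · exact Or.inl hK0
    · subst hKst
      exact Or.inr ⟨_, hk1, ⟨υ₂ ⁻¹ᵁ V, Set.preimage_mono (hZE.trans hEV), hk2⟩, hk3, hk4 _ _ _, hk5, hk6⟩
  have hEc : ((⟨E, hE⟩ : Closeds G) : Set G) ⊆ closure (((⟨E, hE⟩ : Closeds G) : Set G) \ (⟨Z, hZ⟩ : Closeds G)) := hEZ
  have ho1 : (strictTransformIdeal τ (𝓔 ⊔ 𝒦) 𝓔).comap j₂ =
      vanishingIdeal (⟨closure (υ₂ ⁻¹' (E \ Z)), isClosed_closure⟩ : Closeds G') :=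
    coneRound_exceptional_comap 𝓔 𝒦 hk_vi hτ hcart ⟨E, hE⟩ ⟨Z, hZ⟩ he_i hυ₂ hEc
  have ho2 : ∀ z : X₂, (stalkIdeal (strictTransformIdeal τ (𝓔 ⊔ 𝒦) 𝓔) z).IsPrincipal := fun z =>
    isPrincipal_stalkIdeal_strictTransformIdeal hXreg hCreg hτ hCne 𝓔 he_ii z
  obtain ⟨e𝓔, he𝓔⟩ := exists_iso_subscheme_strictTransformIdeal_exceptional 𝓔 𝒦 hk_vi hτ
  have ho3 : Scheme.IsRegular (strictTransformIdeal τ (𝓔 ⊔ 𝒦) 𝓔).subscheme :=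
    Scheme.IsRegular.of_isOpenImmersion e𝓔.hom he_iii
  have ho4 : (τ ≫ σ) '' ((strictTransformIdeal τ (𝓔 ⊔ 𝒦) 𝓔).support : Set X₂) ⊆ {p : P | ¬ IsGenericPoint p Y} := by
    rintro _ ⟨z, hz, rfl⟩
    have hz' : z ∈ ((𝓔.comap τ).support : Set X₂) :=
      Scheme.IdealSheafData.support_antitone (comap_le_strictTransformIdeal τ (𝓔 ⊔ 𝒦) 𝓔) hz
    rw [Scheme.IdealSheafData.support_comap] at hz'
    exact he_iv ⟨τ z, hz', rfl⟩
  have ho5 : Ruled F₉ Z₉ hZ₉ F₁₀ υ' G' (υ₂ ≫ γ) (closure (υ₂ ⁻¹' (E \ Z))) X₂ (τ ≫ σ) j₂ (strictTransformIdeal τ (𝓔 ⊔ 𝒦) 𝓔) :=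
    hRuledIso G G' γ _ E _ X X₂ σ jG j₂ 𝓔 _ τ ⟨e𝓔, he𝓔⟩ he_v
  have hsep : strictTransformIdeal τ (𝓔 ⊔ 𝒦) 𝓔 ⊔ strictTransformIdeal τ (𝓔 ⊔ 𝒦) 𝒦 = ⊤ :=
    strictTransformIdeal_sup_strictTransformIdeal_eq_top τ 𝓔 𝒦 hτ he_ii hk_i
  haveI hempty : IsEmpty (strictTransformIdeal τ (𝓔 ⊔ 𝒦) 𝓔 ⊔ strictTransformIdeal τ (𝓔 ⊔ 𝒦) 𝒦).subscheme := by
    rw [← (Scheme.IdealSheafData.subschemeι _).ker_eq_top_iff_isEmpty, Scheme.IdealSheafData.ker_subschemeι]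
    exact hsep
  have hok3 : Flat ((strictTransformIdeal τ (𝓔 ⊔ 𝒦) 𝓔 ⊔ strictTransformIdeal τ (𝓔 ⊔ 𝒦) 𝒦).subschemeι ≫ (τ ≫ σ) ≫ q) :=
    inferInstance
  have hok4 : ∀ (E'' : Set G') (hE'' : IsClosed E'') (K'' : Set G') (y : G'),
      j₂ y ∈ ((strictTransformIdeal τ (𝓔 ⊔ 𝒦) 𝓔 ⊔ strictTransformIdeal τ (𝓔 ⊔ 𝒦) 𝒦).support : Set X₂) →
      stalkIdeal (vanishingIdeal (⟨E'', hE''⟩ : Closeds G') ⊔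
        vanishingIdeal (⟨closure K'', isClosed_closure⟩ : Closeds G')) y =
      stalkIdeal (vanishingIdeal (⟨E'' ∩ closure K'', hE''.inter isClosed_closure⟩ : Closeds G')) y →
      IsRegularLocalRing (X₂.presheaf.stalk (j₂ y) ⧸
        stalkIdeal (strictTransformIdeal τ (𝓔 ⊔ 𝒦) 𝓔 ⊔ strictTransformIdeal τ (𝓔 ⊔ 𝒦) 𝒦) (j₂ y)) := by
    intro E'' hE'' K'' y hy _
    rw [hsep, Scheme.IdealSheafData.support_top] at hy
    exact absurd hy (by simp)
  have hcomap_top : ∀ (I J : X₂.IdealSheafData), I ⊔ J = ⊤ → I.comap J.subschemeι = ⊤ := by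
    intro I J hIJ
    rw [← Scheme.IdealSheafData.support_eq_bot_iff, eq_bot_iff]
    intro s hs
    rw [Scheme.IdealSheafData.support_comap] at hs
    have h1 : J.subschemeι s ∈ (J.support : Set X₂) := by
      rw [← Scheme.IdealSheafData.range_subschemeι]; exact ⟨s, rfl⟩
    have h2 : J.subschemeι s ∈ ((I ⊔ J).support : Set X₂) := by
      rw [Scheme.IdealSheafData.support_sup]; exact ⟨hs, h1⟩
    rw [hIJ, Scheme.IdealSheafData.support_top] at h2
    exact absurd h2 (by simp)
  have hok5 : IsEffectiveCartier ((strictTransformIdeal τ (𝓔 ⊔ 𝒦) 𝓔).comap (strictTransformIdeal τ (𝓔 ⊔ 𝒦) 𝒦).subschemeι) := by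
    rw [hcomap_top _ _ hsep]; exact isEffectiveCartier_top
  have hok6 : IsEffectiveCartier ((strictTransformIdeal τ (𝓔 ⊔ 𝒦) 𝒦).comap (strictTransformIdeal τ (𝓔 ⊔ 𝒦) 𝓔).subschemeι) := by
    rw [hcomap_top _ _ (by rw [sup_comm]; exact hsep)]; exact isEffectiveCartier_top
  have hExcOld : ∀ hE' : IsClosed (closure (υ₂ ⁻¹' (E \ Z))),
      Tower.Exc₄ O P q Y Ruled Z₉ hZ₉ υ' G' (υ₂ ≫ γ) (closure (υ₂ ⁻¹' (E \ Z))) hE' K' X₂ (τ ≫ σ) j₂ := by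
    intro hE'
    refine ⟨strictTransformIdeal τ (𝓔 ⊔ 𝒦) 𝓔, ho1, ho2, ho3, ho4, ho5, ?_⟩
    rcases hK' with hK0 | hKst
    · exact Or.inl hK0
    · subst hKst
      exact Or.inr ⟨_, hk1, ⟨υ₂ ⁻¹ᵁ V, (closure_minimal (Set.preimage_mono fun x hx => hx.1) (hE.preimage υ₂.continuous)).trans
        (Set.preimage_mono hEV), hk2⟩, hok3, hok4 _ _ _, hok5, hok6⟩
  have hExcOld₀ : ∀ hE' : IsClosed (closure (υ₂ ⁻¹' (E \ Z))),
      Tower.Exc₄ O P q Y Ruled Z₉ hZ₉ υ' G' (υ₂ ≫ γ) (closure (υ₂ ⁻¹' (E \ Z))) hE' ∅ X₂ (τ ≫ σ) j₂ :=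
    fun hE' => Tower.exc₄_forgetShadow O P q Y Ruled (hExcOld hE')
  have hRuledAway : ∀ (F : Set G) (𝓕 : X.IdealSheafData),
      (∃ e : (𝓕.comap τ).subscheme ≅ 𝓕.subscheme, e.hom ≫ 𝓕.subschemeι = (𝓕.comap τ).subschemeι ≫ τ) →
      Ruled F₉ Z₉ hZ₉ F₁₀ υ' G γ F X σ jG 𝓕 →
      Ruled F₉ Z₉ hZ₉ F₁₀ υ' G' (υ₂ ≫ γ) (closure (υ₂ ⁻¹' (F \ Z))) X₂ (τ ≫ σ) j₂ (𝓕.comap τ) :=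
    fun F 𝓕 he hR => hRuledIso G G' γ _ F _ X X₂ σ jG j₂ 𝓕 _ τ he hR
  have hEs'B : ∀ F' ∈ Es', IsClosed F' ∧ ¬ closure (υ₂ ⁻¹' (T \ Z)) ⊆ F' := by
    intro F' hF'
    obtain ⟨F, hFmem, ⟨hrule, rfl⟩⟩ := hEs' F' hF'
    obtain ⟨hF, hTF, -⟩ := hCand F hFmem
    exact ⟨isClosed_closure, not_closure_preimage_diff_subset hυ₂ hTirr hF hZ hTF hTZ hsuppZ.le⟩
  have hEs'Exc : ∀ F' ∈ Es', ∀ hF' : IsClosed F',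
      Tower.Exc₄ O P q Y Ruled Z₉ hZ₉ υ' G' (υ₂ ≫ γ) F' hF' ∅ X₂ (τ ≫ σ) j₂ := by
    intro F' hF'
    obtain ⟨F, hFmem, ⟨hrule, rfl⟩⟩ := hEs' F' hF'
    rcases hrule with rfl | hdisjZF | hX3
    · exact hExcOld₀
    · obtain ⟨hF, -, hExcF0⟩ := hCand F hFmem
      exact Tower.exc₄_transport_away O P q Y Ruled hτ hυ₂ hsuppZ hcomm hRuledAway hF hExcF0 hdisjZF
        (fun 𝓕 h𝓕 => disjoint_support_centre_of_trace (σ ≫ q) (𝓔 ⊔ 𝒦) 𝓕 hF hCDpts h𝓕 hdisjZF)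
    · -- a member CROSSED by the centre: B-TRACE (T23-A′), dischargers from `hSNC` / `hTrace`
      obtain ⟨hF, hTF, hExcF0⟩ := hCand F hFmem
      have hRuledSt' : ∀ (F₀ : Set G) (F₀' : Set G') (𝓕 : X.IdealSheafData), Ruled F₉ Z₉ hZ₉ F₁₀ υ' G γ F₀ X σ jG 𝓕 →
          Ruled F₉ Z₉ hZ₉ F₁₀ υ' G' (υ₂ ≫ γ) F₀' X₂ (τ ≫ σ) j₂ (strictTransformIdeal τ (𝓔 ⊔ 𝒦) 𝓕) :=
        fun F₀ F₀' 𝓕 hR => hRuledSt G G' γ _ F₀ F₀' X X₂ σ jG j₂ 𝓕 _ τ hτ inferInstance inferInstance hR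
      exact Tower.exc₄_transport_transversal' O P q Y Ruled hτ hXreg hCreg hCne hRuledSt' hF hExcF0
        (fun 𝓕 h1 h2 h3 h4 h5 => hSNC (𝓔 ⊔ 𝒦) 𝓕 F hF hX3 inferInstance hCD hk_iii hCreg h1 h2 h3 h4 h5 hTF)
        (fun 𝓕 h1 h2 h3 h4 h5 hE => hTrace (𝓔 ⊔ 𝒦) 𝓕 F hF X₂ τ j₂ t₂ hX3 inferInstance hCD hk_iii hCreg hτ inferInstance hsq₂ hcomm
          h1 h2 h3 h4 h5 hTF hE)
  -- the model-less list: topology only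
  have hNs'B : ∀ F' ∈ Ns', IsClosed F' ∧ ¬ closure (υ₂ ⁻¹' (T \ Z)) ⊆ F' := by
    intro F' hF'
    obtain ⟨F, hFmem, rfl⟩ := hNs' F' hF'
    have hFB : IsClosed F ∧ ¬ T ⊆ F := by
      rcases hFmem with hN | hC
      · exact hNs F hN
      · rcases List.mem_cons.mp hC with rfl | hC
        · exact ⟨hE, hTE₀⟩
        · obtain ⟨hF, hTF, -⟩ := hCand F hC
          exact ⟨hF, hTF⟩
    exact Tower.ns_transport_of_closed hυ₂ hTirr hZ hTZ hsuppZ.le hFB.1 hFB.2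
  rcases hE' with rfl | rfl
  · exact ⟨hυ', hZinf, hF₂, isClosed_closure, hirr, hZ.preimage υ₂.continuous, hTEnew, hEs'B, hNs'B, X₂, τ ≫ σ, _, j₂, t₂, hCh₂, hint₂,
      hnoeth₂, hreg₂, hdom₂, hsq₂, rfl, hExcNew, hEs'Exc⟩
  · exact ⟨hυ', hZinf, hF₂, isClosed_closure, hirr, isClosed_closure, hTEold, hEs'B, hNs'B, X₂, τ ≫ σ, _, j₂, t₂, hCh₂, hint₂,
      hnoeth₂, hreg₂, hdom₂, hsq₂, rfl, hExcOld, hEs'Exc⟩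

end Summit.ResolutionOfSingularities.ResolutionOfSingularities.Cruxes.EquisingularLiftNat.Sections

end
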